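import Summits.ResolutionOfSingularities.ResolutionOfSingularities.Theorems.PurelyInseparableDim4ChartAtlasSNCGoodFarPairsChartJ
import Summits.ResolutionOfSingularities.ResolutionOfSingularities.Theorems.PurelyInseparableDim4ChartAtlasSNCFarShearPairs
import HarnessLib

/-!
# Purely inseparable four-folds `z^p + F(x₁, …, x₄)`: the transformed boundary of a PAIR-LIST of old members (parallel members allowed), read on the
# charts of the S3-N1 atlas, escaping case `j ∉ S'` (S3-N2 positive side; cell `res-dim4-pi`, typ-2 g6)

[OURS · counted 0] (D-0157 DOOR 2; DR-157-C; typ-2 HANDOFF OPEN item «parallel members of equal index»). p703421 read the old boundary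
`[(xᵢ + cᵢ)·𝒪 : i ∈ ms] ++ [(xᵢ + dᵢ)·𝒪 : i ∈ fs]` (one member per index). Here the old boundary is ANY list of pairs
`E = [(x_{i} + c)·𝒪 : (i, c) ∈ L]` — NEAR when `i ∈ S ∧ c = 0`, FAR when `i ∈ S ∧ c ≠ 0`, TRANSVERSAL when `i ∉ S`; parallel members `(i, c), (i, c')`
allowed. PROVED here (no `sorry`, no new axiom): `hasSNCWith_boundary_readings_shear_chart_pairs` (shear chart `x_l`, via p709808's pair shear chart theorem), under
`|B_near| ≤ 1` and pairwise distinct active far heights, phrased on the pairs (the `x_j`-chart is the companion file `…GoodFarPairsChartJ`). Nothing here is a statement about resolution of singularities in dimension ≥ 4 / characteristic `p` (NOT proved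
anywhere in this programme). bears_on: LADDER-RESOLUTION:D157-DOOR2 (res-dim4-pi). Supports stmt-ResolutionOfSingularities-16155 (helper).
-/

-- every declaration of this summit lives under `Summit.ResolutionOfSingularities.ResolutionOfSingularities`
-- (summit = problem), which the duplicate-namespace linter flags; house convention (cf. the Target file).
set_option linter.dupNamespace false

noncomputable section

open MvPolynomial CategoryTheory AlgebraicGeometry Opposite TopologicalSpace
open AlgebraicGeometry.Scheme.IdealSheafData (ofIdealTop)

namespace Summit.ResolutionOfSingularities.ResolutionOfSingularities.Theorems.PIDim4

open Literature.AlgebraicGeometry.Resolution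
open Literature.AlgebraicGeometry.Resolution.AffinePointBlowup (P A γ coord Wtop ξ)

namespace ChartDictionary

variable {K : Type} [Field K]

section ShearChart

variable {S S' : Finset (Fin 4)} {j l : Fin 4} {b : Fin 4 → K} {Θ : A 4 K ≃ₐ[K] A 4 K}
  {τ : MvPolynomial (Fin 4) K ≃ₐ[K] MvPolynomial (Fin 4) K} {W : Scheme.{0}} {π : W ⟶ P 4 K}

/-- **PAIR-LIST BOUNDARY ON A SHEAR CHART `x_l` (`l ∈ S ∖ S'`, `l ≠ j`): snc with the escaping centre `V(y_0, y_{S'})`** under `|B_near| ≤ 1` (on pairs: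
`(j, 0) ∈ L →` no near `(m, 0)`, `m ∈ S ∩ S'`, with `b_m ≠ 0`; at most one such `m`) and pairwise distinct active far heights. -/
theorem hasSNCWith_boundary_readings_shear_chart_pairs (hl : l ∈ S) (hj : j ∈ S) (hjS' : j ∉ S') (hjl : j ≠ l)
    (L : List (Fin 4 × K)) (hτ : ∀ k : Fin 4, Θ (X k.succ) = rename Fin.succ (τ (X k))) (hτj : τ (X j) = X j) (hτl : τ (X l) = X l)
    (hτS : ∀ i ∈ S, i ≠ j → i ≠ l → τ (X i) = X i + C (b i) * X j) (hτk : ∀ k ∉ S, τ (X k) = X k + C (b k))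
    (hB1 : (j, (0 : K)) ∈ L → ∀ mc ∈ L, mc.1 ∈ S → mc.1 ∈ S' → mc.2 = 0 → b mc.1 = 0)
    (hB2 : ∀ mc ∈ L, ∀ mc' ∈ L, mc.1 ∈ S → mc'.1 ∈ S → mc.1 ∈ S' → mc'.1 ∈ S' → mc.2 = 0 → mc'.2 = 0 → b mc.1 ≠ 0 → b mc'.1 ≠ 0 →
      mc.1 = mc'.1)
    (hH1 : ∀ ic ∈ L, ic.1 ∈ S → ic.2 ≠ 0 → ic.1 ∈ S' → b ic.1 ≠ 0 → ∀ c : K, (j, c) ∈ L → c ≠ 0 → ic.2 ≠ b ic.1 * c)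
    (hH2 : ∀ ic ∈ L, ∀ kd ∈ L, ic ≠ kd → ic.1 ∈ S → kd.1 ∈ S → ic.2 ≠ 0 → kd.2 ≠ 0 → ic.1 ∈ S' → kd.1 ∈ S' → b ic.1 ≠ 0 → b kd.1 ≠ 0 →
      ic.2 * b kd.1 ≠ kd.2 * b ic.1)
    (hπ : IsBlowup π (AffineCoordBlowup.𝓘Λ 4 K (insert 0 (Fin.succ '' (S : Set (Fin 4)))))) :
    haveI : IsIso (CommRingCat.ofHom (Θ : A 4 K →+* A 4 K)) := (inferInstance : IsIso Θ.toRingEquiv.toCommRingCatIso.hom)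
    HasSNCWith (((L.map fun ic => ofIdealTop (Ideal.span {(γ 4 K).symm (X ic.1.succ + C ic.2)})).map
        (strictTransformIdeal π (AffineCoordBlowup.𝓘Λ 4 K (insert 0 (Fin.succ '' (S : Set (Fin 4)))))) ++
        [(AffineCoordBlowup.𝓘Λ 4 K (insert 0 (Fin.succ '' (S : Set (Fin 4))))).comap π]).map
        (·.comap (Spec.map (CommRingCat.ofHom (Θ : A 4 K →+* A 4 K)) ≫ AffineCoordBlowup.chartImm hπ (succ_mem_centreVars hl))))
      (AffineCoordBlowup.𝓘Λ 4 K (insert 0 (Fin.succ '' (S' : Set (Fin 4))))) := by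
  classical
  haveI : IsIso (CommRingCat.ofHom (Θ : A 4 K →+* A 4 K)) := (inferInstance : IsIso Θ.toRingEquiv.toCommRingCatIso.hom)
  -- hyperplanes: `E₁ = (l⁺, 0)`; old `{x_j = 0}` ↦ `(j⁺, 0)`; near `(i, 0)`, `i ∈ S ∖ {j, l}`, `bᵢ = 0` ↦ `(i⁺, 0)`; far `{x_l = -c}` ↦ `(l⁺, c)`;
  -- transversal `(i, c)`, `i ∉ S` ↦ `(i⁺, bᵢ + c)`
  let H : Finset (Fin (4 + 1) × K) := insert (l.succ, (0 : K))
    (((L.toFinset.filter fun ic => ic = (j, 0)).image fun _ => (j.succ, (0 : K))) ∪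
      ((L.toFinset.filter fun ic => ic.1 ∈ S ∧ ic.1 ≠ j ∧ ic.1 ≠ l ∧ ic.2 = 0 ∧ b ic.1 = 0).image fun ic => (ic.1.succ, (0 : K))) ∪
      ((L.toFinset.filter fun ic => ic.1 = l ∧ ic.2 ≠ 0).image fun ic => (l.succ, ic.2)) ∪
      ((L.toFinset.filter fun ic => ic.1 ∉ S).image fun ic => (ic.1.succ, b ic.1 + ic.2)))
  let sh : Finset (Fin 4) := (L.toFinset.filter fun ic => ic.1 ∈ S ∧ ic.1 ≠ j ∧ ic.1 ≠ l ∧ ic.2 = 0 ∧ b ic.1 ≠ 0).image Prod.fst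
  let FJ : Finset K := (L.toFinset.filter fun ic => ic.1 = j ∧ ic.2 ≠ 0).image Prod.snd
  let FQ : Finset (Fin 4 × K) := L.toFinset.filter fun ic => ic.1 ∈ S ∧ ic.1 ≠ j ∧ ic.1 ≠ l ∧ ic.2 ≠ 0
  have hHmem : ∀ ka, ka ∈ H → ka = (l.succ, (0 : K)) ∨ ((j, (0 : K)) ∈ L ∧ ka = (j.succ, 0)) ∨
      (∃ i, (i, (0 : K)) ∈ L ∧ i ∈ S ∧ i ≠ j ∧ i ≠ l ∧ b i = 0 ∧ ka = (i.succ, 0)) ∨ (∃ c, (l, c) ∈ L ∧ c ≠ 0 ∧ ka = (l.succ, c)) ∨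
      ∃ ic ∈ L, ic.1 ∉ S ∧ ka = (ic.1.succ, b ic.1 + ic.2) := by
    intro ka hka
    simp only [H, Finset.mem_insert, Finset.mem_union, Finset.mem_image, Finset.mem_filter, List.mem_toFinset] at hka
    rcases hka with h | (((⟨ic, ⟨hic, hj0⟩, rfl⟩ | ⟨ic, ⟨hic, hiS, hij, hil, hc0, hb0⟩, rfl⟩) | ⟨ic, ⟨hic, hil, hc⟩, rfl⟩) | ⟨ic, ⟨hic, hiS⟩, rfl⟩)
    · exact Or.inl h
    · exact Or.inr (Or.inl ⟨hj0 ▸ hic, rfl⟩)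
    · exact Or.inr (Or.inr (Or.inl ⟨ic.1, by rw [← hc0]; exact hic, hiS, hij, hil, hb0, rfl⟩))
    · exact Or.inr (Or.inr (Or.inr (Or.inl ⟨ic.2, by rw [← hil]; exact hic, hc, rfl⟩)))
    · exact Or.inr (Or.inr (Or.inr (Or.inr ⟨ic, hic, hiS, rfl⟩)))
  have hsh : ∀ m, m ∈ sh ↔ (m, (0 : K)) ∈ L ∧ m ∈ S ∧ m ≠ j ∧ m ≠ l ∧ b m ≠ 0 := by
    intro m
    simp only [sh, Finset.mem_image, Finset.mem_filter, List.mem_toFinset]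
    constructor
    · rintro ⟨ic, ⟨hic, hiS, hij, hil, hc0, hb⟩, rfl⟩; exact ⟨by rw [← hc0]; exact hic, hiS, hij, hil, hb⟩
    · rintro ⟨hm, hmS, hmj, hml, hb⟩; exact ⟨(m, 0), ⟨hm, hmS, hmj, hml, rfl, hb⟩, rfl⟩
  have hFJ : ∀ c, c ∈ FJ ↔ (j, c) ∈ L ∧ c ≠ 0 := by
    intro c
    simp only [FJ, Finset.mem_image, Finset.mem_filter, List.mem_toFinset]
    constructor
    · rintro ⟨ic, ⟨hic, hij, hc⟩, rfl⟩; exact ⟨by rw [← hij]; exact hic, hc⟩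
    · rintro ⟨hc, hc0⟩; exact ⟨(j, c), ⟨hc, rfl, hc0⟩, rfl⟩
  have hFQ : ∀ id, id ∈ FQ ↔ id ∈ L ∧ id.1 ∈ S ∧ id.1 ≠ j ∧ id.1 ≠ l ∧ id.2 ≠ 0 := fun id => by
    simp only [FQ, Finset.mem_filter, List.mem_toFinset]
  refine hasSNCWith_𝓘Λ_of_forall_mem_far_shear_pairs (K := K) (T := S') (j := j) (l := l) (b := b) hjS' hjl H sh FJ FQ
    (fun h => ((hsh j).mp h).2.2.1 rfl) (fun h => ((hsh l).mp h).2.2.2.1 rfl) (fun m hm => ((hsh m).mp hm).2.2.2.2)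
    (fun c hc => ((hFJ c).mp hc).2) (fun id hid => ⟨((hFQ id).mp hid).2.2.1, ((hFQ id).mp hid).2.2.2.1, ((hFQ id).mp hid).2.2.2.2⟩)
    ?_ ?_ ?_ ?_ ?_ ?_ ?_ ?_
  · -- hyperplanes of index `j` have constant `0`
    intro a ha
    rcases hHmem _ ha with e | ⟨-, e⟩ | ⟨i, -, -, hij, -, -, e⟩ | ⟨c, -, -, e⟩ | ⟨ic, -, hicS, e⟩
    · exact absurd (Fin.succ_injective _ (Prod.mk.inj e).1) hjl
    · exact (Prod.mk.inj e).2
    · exact absurd (Fin.succ_injective _ (Prod.mk.inj e).1).symm hij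
    · exact absurd (Fin.succ_injective _ (Prod.mk.inj e).1) hjl
    · exact absurd ((Fin.succ_injective _ (Prod.mk.inj e).1) ▸ hj) hicS
  · -- no hyperplane of a sheared index
    intro m hm a ha
    obtain ⟨-, hmS, hmj, hml, hbm⟩ := (hsh m).mp hm
    rcases hHmem _ ha with e | ⟨-, e⟩ | ⟨i, -, -, -, -, hb0, e⟩ | ⟨c, -, -, e⟩ | ⟨ic, -, hicS, e⟩
    · exact hml (Fin.succ_injective _ (Prod.mk.inj e).1)
    · exact hmj (Fin.succ_injective _ (Prod.mk.inj e).1)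
    · exact hbm ((Fin.succ_injective _ (Prod.mk.inj e).1) ▸ hb0)
    · exact hml (Fin.succ_injective _ (Prod.mk.inj e).1)
    · exact hicS ((Fin.succ_injective _ (Prod.mk.inj e).1) ▸ hmS)
  · -- hyperplanes of a far pair's index
    intro id hid a ha
    obtain ⟨-, hiS, hij, hil, -⟩ := (hFQ id).mp hid
    rcases hHmem _ ha with e | ⟨-, e⟩ | ⟨i, -, -, -, -, hb0, e⟩ | ⟨c, -, -, e⟩ | ⟨ic, -, hicS, e⟩
    · exact absurd (Fin.succ_injective _ (Prod.mk.inj e).1) hil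
    · exact absurd (Fin.succ_injective _ (Prod.mk.inj e).1) hij
    · obtain ⟨e1, e2⟩ := Prod.mk.inj e
      exact ⟨e2, (Fin.succ_injective _ e1) ▸ hb0⟩
    · exact absurd (Fin.succ_injective _ (Prod.mk.inj e).1) hil
    · exact absurd ((Fin.succ_injective _ (Prod.mk.inj e).1) ▸ hiS) hicS
  · -- `{x_j = 0}` old ⟹ nothing sheared into the centre
    intro hmem m hm hmS'
    obtain ⟨hmL, hmS, -, -, hbm⟩ := (hsh m).mp hm
    have hj0 : (j, (0 : K)) ∈ L := by
      rcases hHmem _ hmem with e | ⟨h, -⟩ | ⟨i, -, -, hij, -, -, e⟩ | ⟨c, -, -, e⟩ | ⟨ic, -, hicS, e⟩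
      · exact absurd (Fin.succ_injective _ (Prod.mk.inj e).1) hjl
      · exact h
      · exact absurd (Fin.succ_injective _ (Prod.mk.inj e).1).symm hij
      · exact absurd (Fin.succ_injective _ (Prod.mk.inj e).1) hjl
      · exact absurd ((Fin.succ_injective _ (Prod.mk.inj e).1) ▸ hj) hicS
    exact hbm (hB1 hj0 (m, 0) hmL hmS hmS' rfl)
  · -- at most one member sheared into the centre
    intro m hm m' hm' hmS' hm'S'
    obtain ⟨hmL, hmS, -, -, hbm⟩ := (hsh m).mp hm
    obtain ⟨hm'L, hm'S, -, -, hbm'⟩ := (hsh m').mp hm'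
    exact hB2 (m, 0) hmL (m', 0) hm'L hmS hm'S hmS' hm'S' rfl rfl hbm hbm'
  · -- heights: `F_j` against an active `F_{i,d}`
    intro id hid hiS' hbi c hc
    obtain ⟨hidL, hiS, -, -, hd⟩ := (hFQ id).mp hid
    obtain ⟨hcL, hc0⟩ := (hFJ c).mp hc
    exact hH1 id hidL hiS hd hiS' hbi c hcL hc0
  · -- heights: two active pairs
    intro id hid kd hkd hne hiS' hkS' hbi hbk
    obtain ⟨hidL, hiS, -, -, hd⟩ := (hFQ id).mp hid
    obtain ⟨hkdL, hkS, -, -, hd'⟩ := (hFQ kd).mp hkd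
    exact hH2 id hidL kd hkdL hne hiS hkS hd hd' hiS' hkS' hbi hbk
  · -- the members, read on the chart
    intro D hD
    rw [List.map_append, List.map_map, List.map_map, List.mem_append, List.mem_map, List.map_singleton, List.mem_singleton] at hD
    rcases hD with ⟨ic, hic, rfl⟩ | rfl
    · simp only [Function.comp_apply]
      by_cases hil : ic.1 = l
      · by_cases hc : ic.2 = 0
        · left
          have e1 : ic = (l, 0) := Prod.ext hil hc
          rw [e1, C_0, add_zero, show (γ 4 K).symm (X l.succ) = coord 4 K l.succ from rfl]
          exact comap_shear_chart_strictTransform_hyperplane_self hl _ hπ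
        · right; left
          refine ⟨(l.succ, ic.2), Finset.mem_insert_of_mem (Finset.mem_union_left _ (Finset.mem_union_right _
            (Finset.mem_image.mpr ⟨ic, Finset.mem_filter.mpr ⟨List.mem_toFinset.mpr hic, hil, hc⟩, rfl⟩))), ?_⟩
          have e1 : ic = (l, ic.2) := Prod.ext hil rfl
          rw [e1]
          exact comap_shear_chart_strictTransform_far_self hl hc hτ hτl hπ
      · by_cases hij : ic.1 = j
        · by_cases hc : ic.2 = 0
          · right; left
            have e1 : ic = (j, 0) := Prod.ext hij hc
            refine ⟨(j.succ, 0), Finset.mem_insert_of_mem (Finset.mem_union_left _ (Finset.mem_union_left _ (Finset.mem_union_left _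
              (Finset.mem_image.mpr ⟨ic, Finset.mem_filter.mpr ⟨List.mem_toFinset.mpr hic, e1⟩, rfl⟩)))), ?_⟩
            rw [e1, C_0, add_zero, show (γ 4 K).symm (X j.succ) = coord 4 K j.succ from rfl]
            exact comap_shear_chart_strictTransform_hyperplane_j hl hjl hτ hτj hπ
          · right; right; right; left
            refine ⟨ic.2, (hFJ _).mpr ⟨by rw [← hij]; exact hic, hc⟩, ?_⟩
            have e1 : ic = (j, ic.2) := Prod.ext hij rfl
            rw [e1]
            exact comap_shear_chart_strictTransform_far_j hl hj hjl hc hτ hτj hτl hπ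
        · by_cases hiS : ic.1 ∈ S
          · by_cases hc : ic.2 = 0
            · by_cases hb0 : b ic.1 = 0
              · right; left
                refine ⟨(ic.1.succ, 0), Finset.mem_insert_of_mem (Finset.mem_union_left _ (Finset.mem_union_left _ (Finset.mem_union_right _
                  (Finset.mem_image.mpr ⟨ic, Finset.mem_filter.mpr ⟨List.mem_toFinset.mpr hic, hiS, hij, hil, hc, hb0⟩, rfl⟩)))), ?_⟩
                rw [hc, C_0, add_zero, show (γ 4 K).symm (X ic.1.succ) = coord 4 K ic.1.succ from rfl]
                have h := comap_shear_chart_strictTransform_hyperplane_shear hl hil hτ (hτS ic.1 hiS hij hil) hπ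
                rw [hb0, C_0, zero_mul, add_zero] at h
                exact h
              · right; right; left
                refine ⟨ic.1, (hsh _).mpr ⟨by rw [← hc]; exact hic, hiS, hij, hil, hb0⟩, ?_⟩
                rw [hc, C_0, add_zero, show (γ 4 K).symm (X ic.1.succ) = coord 4 K ic.1.succ from rfl]
                exact comap_shear_chart_strictTransform_hyperplane_shear hl hil hτ (hτS ic.1 hiS hij hil) hπ
            · right; right; right; right
              exact ⟨ic, (hFQ ic).mpr ⟨hic, hiS, hij, hil, hc⟩, comap_shear_chart_strictTransform_far hl hiS hil hc hτ (hτS ic.1 hiS hij hil) hτl hπ⟩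
          · right; left
            exact ⟨(ic.1.succ, b ic.1 + ic.2), Finset.mem_insert_of_mem (Finset.mem_union_right _
              (Finset.mem_image.mpr ⟨ic, Finset.mem_filter.mpr ⟨List.mem_toFinset.mpr hic, hiS⟩, rfl⟩)),
              comap_shear_chart_strictTransform_translate hl hiS ic.2 hτ (hτk ic.1 hiS) hπ⟩
    · right; left
      exact ⟨(l.succ, 0), Finset.mem_insert_self _ _, comap_shear_chart_exceptional hl hτ hτl hπ⟩

end ShearChart

end ChartDictionary

end Summit.ResolutionOfSingularities.ResolutionOfSingularities.Theorems.PIDim4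

end
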